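import Summits.Ventures.CertifiedManyBodySolver.Downfold.TPrimePinnedPairRowKernelPoly
import HarnessLib

/-!
# The PINNED t′-PAIR shape from window identities / semantic kernel residuals on a LARGER LETTER WINDOW `Λ' ⊇ Λ₇ = box 2 7`
# (`…of_windowIdentities_wide`, `…of_residPolys_wide`) — cell `pub/hubbard-obs` × `pub/hubbard-downfold`, D-0154 (1)(C) COVERAGE La214;
# seat `hubbard-cov-la214-unc-2`, lineage desk; zero compute

HONEST FRAMING: Lean plumbing towards «tier P» for PAIR claim nodes‴. The shape `SquareTTPrimePinnedPairRowT` reads its objective orbit mean on `box 2 7`;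
the pair forms landed so far (p665976 / p668982 / p673208 / p675112 / p677238) therefore take letters and identities in `𝔄_{box 2 7}`. The exporter's real
instances use a WIDER outer table (`box 2 12`, N = 625 letters; hubbard-obs-p2 `Rows/CorrWindowBoxGeometry.lean`). This file removes the restriction: the
identities / residuals live in `𝔄_{Λ'}` for ANY `Λ' ⊇ box 2 7`, the objectives are the embedded words `Γ(incl h7)(X s_v)`, and the bridge
`expect_d4Emb_fermionEmbed_incl` (embedding algebra + compatibility of the local functionals — no new mathematics) returns the shape's `box 2 7` orbit means.
Nothing is asserted: no `def`, no named fact, no `sorry`, no number; nothing is evaluated; CONTROL / CALIBRATION wording class (xx1); no summit statement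
is proved by this file.

References: D. P. Bertsekas, *Nonlinear Programming* (1999) Prop. 5.1.3 [Bertsekas1999NonlinearProgramming]; J. Wang et al., PRX 14 (2024) 031006 §III
[WangEtAl2024]; C. Jansson, D. Chaykin, C. Keil, SIAM J. Numer. Anal. 46 (2008) 180 [JanssonChaykinKeil2008]; H. Araki, H. Moriya, Rev. Math. Phys. 15
(2003) 93, §4.1 (compatibility of local states) [ArakiMoriya2003].
-/

noncomputable section

namespace Summit.Ventures.CertifiedManyBodySolver.Downfold

open Literature.MathematicalPhysics.QuantumLattice
open Matrix HubbardWave0 Literature.Probability.LatticeModels ThermodynamicLimit Filter Topology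
open Literature.MathematicalPhysics.QuantumManyBody.StateRelaxation
open Summit.Ventures.CertifiedQuantumChemistry Summit.Ventures.CertifiedQuantumChemistry.CARPoly
open Summit.Ventures.CertifiedManyBodySolver.CARPolyWindow
open scoped BigOperators ComplexOrder

/-! ## §1 The bridge: rotated embedded words read the same in every infinite-volume state -/

section Bridge

/-- `γ·(ι(Λ ⊆ Λ') y) = ι(γΛ ⊆ γΛ')(γ·y)` on operators, hence **`ω_{γΛ'}(Γ(γ)(Γ(incl) Y)) = ω_{γΛ}(Γ(γ) Y)`** for every infinite-volume state (compatibility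
of the local functionals). [cite: ArakiMoriya2003, §4.1 Def. 4.1 (2)] -/
theorem expect_d4Emb_fermionEmbed_incl (ω : InfVolFermionState 2) {Λ Λ' : Finset (Site 2)} (h : Λ ⊆ Λ') (g : DihedralGroup 4) (Y : FermionOp Λ) :
    ω.expect (d4ShiftSet g 0 Λ') (fermionEmbed (PolySite.d4Emb g 0 Λ') (fermionEmbed (PolySite.incl h) Y)) =
      ω.expect (d4ShiftSet g 0 Λ) (fermionEmbed (PolySite.d4Emb g 0 Λ) Y) := by
  have hsub : d4ShiftSet g 0 Λ ⊆ d4ShiftSet g 0 Λ' := Finset.map_subset_map.2 h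
  have e : fermionEmbed (PolySite.d4Emb g 0 Λ') (fermionEmbed (PolySite.incl h) Y) =
      fermionEmbed (PolySite.incl hsub) (fermionEmbed (PolySite.d4Emb g 0 Λ) Y) := by
    rw [fermionEmbed_fermionEmbed, fermionEmbed_fermionEmbed]
    exact congrFun (congrArg DFunLike.coe (fermionEmbed_congr fun y => rfl)) Y
  rw [e, ω.compatible hsub]

end Bridge

/-! ## §2 Two window identities on `Λ' ⊇ Λ₇` with ONE shared eom word list ⇒ the pinned t′-pair shape -/

section PairWide

/-- **PINNED t′-PAIR SHAPE FROM TWO WINDOW IDENTITIES ON A LARGER WINDOW `Λ' ⊇ Λ₇`.** As `SquareTTPrimePinnedPairRowT.of_windowIdentities` (p665976)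
but the two identities live in `𝔄_{Λ'}` for any `Λ' ⊇ box 2 7` (the exporter's outer table, e.g. `box 2 12`), with objectives `Γ(incl h7)(X s_v)`; the
shape's orbit means over `box 2 7` are recovered by `expect_d4Emb_fermionEmbed_incl`. [cite: Bertsekas1999NonlinearProgramming, Prop. 5.1.3]
[cite: WangEtAl2024, §III] -/
theorem SquareTTPrimePinnedPairRowT.of_windowIdentities_wide
    {U : ℝ} (hU : 0 ≤ U) {n : ℝ} (hn0 : 0 ≤ n) (hn2 : n < 2) (sA sB : ℝ)
    {Λ Λ' : Finset (Site 2)} (h7 : box 2 7 ⊆ Λ') (hΛ : Λ ⊆ Λ') (h8 : thicken Λ 1 ⊆ Λ')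
    (h0 : thicken ({0} : Finset (Site 2)) 1 ⊆ Λ') (hz : (0 : Site 2) ∈ Λ')
    (X : ℝ → FermionOp (box 2 7))
    {κι : Type*} (se : Finset κι) (B : κι → FermionOp Λ)
    -- vertex A
    (μA : Fin 2 → ℝ) (νA : ℝ) (capA flA κA κA' : ℚ)
    {mA : Type*} [Fintype mA] [DecidableEq mA] {ΛmA : Matrix mA mA ℂ} (hΛmA : ΛmA.PosSemidef) (OA : mA → FermionOp Λ')
    {ιA : Type*} (ttA : Finset ιA) (γA : ιA → DihedralGroup 4) (wvA : ιA → Site 2) (hshA : ∀ l, d4ShiftSet (γA l) (wvA l) Λ ⊆ Λ')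
    (YA : ιA → FermionOp Λ)
    {ρA : Type*} (uuA : Finset ρA) (bA : ρA → ℂ) (cwA : ρA → List (Orb (PolySite Λ') × Bool))
    (hcwA : ∀ j ∈ uuA, ladderCharge (cwA j) ≠ 0 ∨ ladderSpinCharge (cwA j) ≠ 0)
    {δA : Type*} (ahA : Finset δA) (dcA : δA → ℝ) (VA : δA → FermionOp Λ')
    {κ''A : Type*} (wA : Finset κ''A) (aA : κ''A → ℂ) (wordA : κ''A → List (Orb (PolySite Λ') × Bool))
    {cA0 : ℝ}
    (hcertA : fermionEmbed (PolySite.incl h7) (X sA) - (cA0 : ℂ) • (1 : FermionOp Λ') -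
        ∑ σ : Fin 2, ((μA σ : ℝ) : ℂ) • (nAt 0 hz σ - ((νA : ℝ) : ℂ) • (1 : FermionOp Λ')) -
        (((κA : ℚ) : ℝ) : ℂ) • ((((capA : ℚ) : ℝ) : ℂ) • (1 : FermionOp Λ') -
          fermionEmbed (PolySite.incl h0) ((hubbardTTPrimeFermionInteraction 1 sA U).meanEnergyObs 1)) -
        (((κA' : ℚ) : ℝ) : ℂ) • (fermionEmbed (PolySite.incl h0) ((hubbardTTPrimeFermionInteraction 1 sA U).meanEnergyObs 1) -
          (((flA : ℚ) : ℝ) : ℂ) • (1 : FermionOp Λ')) =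
      gramForm ΛmA OA +
        (∑ k ∈ se, ((hubbardTTPrimeFermionInteraction 1 sA U).localHamiltonian Λ' * fermionEmbed (PolySite.incl hΛ) (B k) -
            fermionEmbed (PolySite.incl hΛ) (B k) * (hubbardTTPrimeFermionInteraction 1 sA U).localHamiltonian Λ') +
          ∑ l ∈ ttA, (fermionEmbed (PolySite.incl (hshA l)) (fermionEmbed (PolySite.d4Emb (γA l) (wvA l) Λ) (YA l)) -
            fermionEmbed (PolySite.incl hΛ) (YA l)) +
          ∑ j ∈ uuA, bA j • ladderWord (cwA j)) +
        (∑ m' ∈ ahA, ((dcA m' : ℝ) : ℂ) • ((VA m')ᴴ - VA m') + ∑ k ∈ wA, aA k • ladderWord (wordA k)))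
    {βA : ℚ} (hβA : ((βA : ℚ) : ℝ) ≤ cA0 - ∑ k ∈ wA, ‖aA k‖ + (∑ σ : Fin 2, μA σ) * (n / 2 - νA))
    -- vertex B
    (μB : Fin 2 → ℝ) (νB : ℝ) (capB flB κB κB' : ℚ)
    {mB : Type*} [Fintype mB] [DecidableEq mB] {ΛmB : Matrix mB mB ℂ} (hΛmB : ΛmB.PosSemidef) (OB : mB → FermionOp Λ')
    {ιB : Type*} (ttB : Finset ιB) (γB : ιB → DihedralGroup 4) (wvB : ιB → Site 2) (hshB : ∀ l, d4ShiftSet (γB l) (wvB l) Λ ⊆ Λ')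
    (YB : ιB → FermionOp Λ)
    {ρB : Type*} (uuB : Finset ρB) (bB : ρB → ℂ) (cwB : ρB → List (Orb (PolySite Λ') × Bool))
    (hcwB : ∀ j ∈ uuB, ladderCharge (cwB j) ≠ 0 ∨ ladderSpinCharge (cwB j) ≠ 0)
    {δB : Type*} (ahB : Finset δB) (dcB : δB → ℝ) (VB : δB → FermionOp Λ')
    {κ''B : Type*} (wB : Finset κ''B) (aB : κ''B → ℂ) (wordB : κ''B → List (Orb (PolySite Λ') × Bool))
    {cB0 : ℝ}
    (hcertB : fermionEmbed (PolySite.incl h7) (X sB) - (cB0 : ℂ) • (1 : FermionOp Λ') -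
        ∑ σ : Fin 2, ((μB σ : ℝ) : ℂ) • (nAt 0 hz σ - ((νB : ℝ) : ℂ) • (1 : FermionOp Λ')) -
        (((κB : ℚ) : ℝ) : ℂ) • ((((capB : ℚ) : ℝ) : ℂ) • (1 : FermionOp Λ') -
          fermionEmbed (PolySite.incl h0) ((hubbardTTPrimeFermionInteraction 1 sB U).meanEnergyObs 1)) -
        (((κB' : ℚ) : ℝ) : ℂ) • (fermionEmbed (PolySite.incl h0) ((hubbardTTPrimeFermionInteraction 1 sB U).meanEnergyObs 1) -
          (((flB : ℚ) : ℝ) : ℂ) • (1 : FermionOp Λ')) =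
      gramForm ΛmB OB +
        (∑ k ∈ se, ((hubbardTTPrimeFermionInteraction 1 sB U).localHamiltonian Λ' * fermionEmbed (PolySite.incl hΛ) (B k) -
            fermionEmbed (PolySite.incl hΛ) (B k) * (hubbardTTPrimeFermionInteraction 1 sB U).localHamiltonian Λ') +
          ∑ l ∈ ttB, (fermionEmbed (PolySite.incl (hshB l)) (fermionEmbed (PolySite.d4Emb (γB l) (wvB l) Λ) (YB l)) -
            fermionEmbed (PolySite.incl hΛ) (YB l)) +
          ∑ j ∈ uuB, bB j • ladderWord (cwB j)) +
        (∑ m' ∈ ahB, ((dcB m' : ℝ) : ℂ) • ((VB m')ᴴ - VB m') + ∑ k ∈ wB, aB k • ladderWord (wordB k)))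
    {βB : ℚ} (hβB : ((βB : ℚ) : ℝ) ≤ cB0 - ∑ k ∈ wB, ‖aB k‖ + (∑ σ : Fin 2, μB σ) * (n / 2 - νB)) :
    SquareTTPrimePinnedPairRowT U n sA sB capA capB flA flB βA κA κA' βB κB κB' X := by
  have h1 : (1 : DihedralGroup 4) ∈ (Finset.univ : Finset (DihedralGroup 4)) := Finset.mem_univ _
  have hmul : ∀ a ∈ (Finset.univ : Finset (DihedralGroup 4)), ∀ b ∈ (Finset.univ : Finset (DihedralGroup 4)),
      a * b ∈ (Finset.univ : Finset (DihedralGroup 4)) := fun _ _ _ _ => Finset.mem_univ _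
  refine ⟨fun ω => ((Finset.univ : Finset (DihedralGroup 4)).card : ℝ)⁻¹ * ∑ g ∈ (Finset.univ : Finset (DihedralGroup 4)),
      (ω.expect (d4ShiftSet g 0 Λ') (fermionEmbed (PolySite.d4Emb g 0 Λ')
          (∑ k ∈ se, ((hubbardTTPrimeFermionInteraction 1 0 U).localHamiltonian Λ' * fermionEmbed (PolySite.incl hΛ) (B k) -
            fermionEmbed (PolySite.incl hΛ) (B k) * (hubbardTTPrimeFermionInteraction 1 0 U).localHamiltonian Λ')))).re,
    fun ω => ((Finset.univ : Finset (DihedralGroup 4)).card : ℝ)⁻¹ * ∑ g ∈ (Finset.univ : Finset (DihedralGroup 4)),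
      (ω.expect (d4ShiftSet g 0 Λ') (fermionEmbed (PolySite.d4Emb g 0 Λ')
          (∑ k ∈ se, ((hubbardTTPrimeFermionInteraction 0 1 0).localHamiltonian Λ' * fermionEmbed (PolySite.incl hΛ) (B k) -
            fermionEmbed (PolySite.incl hΛ) (B k) * (hubbardTTPrimeFermionInteraction 0 1 0).localHamiltonian Λ')))).re,
    fun s _ ω Ls ψ hLs hψ hψ1 hω => ⟨?_, ?_, ?_⟩⟩
  · exact pinnedStationarity hU hn0 hn2 s hΛ h8 h0 hz h1 hmul se B hLs hψ hψ1 hω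
  · have h := pinnedVertexRow_of_windowIdentity hU hn0 hn2 sA s hΛ h8 h0 hz h1 hmul (fermionEmbed (PolySite.incl h7) (X sA)) μA νA capA flA κA κA' hΛmA OA se B
      ttA γA (fun l _ => Finset.mem_univ _) wvA hshA YA uuA bA cwA hcwA ahA dcA VA wA aA wordA hcertA hLs hψ hψ1 hω
    simp_rw [expect_d4Emb_fermionEmbed_incl ω h7] at h
    unfold tPrimeObjOrbitMean
    linarith
  · have h := pinnedVertexRow_of_windowIdentity hU hn0 hn2 sB s hΛ h8 h0 hz h1 hmul (fermionEmbed (PolySite.incl h7) (X sB)) μB νB capB flB κB κB' hΛmB OB se B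
      ttB γB (fun l _ => Finset.mem_univ _) wvB hshB YB uuB bB cwB hcwB ahB dcB VB wB aB wordB hcertB hLs hψ hψ1 hω
    simp_rw [expect_d4Emb_fermionEmbed_incl ω h7] at h
    unfold tPrimeObjOrbitMean
    linarith

end PairWide

/-! ## §3 Semantic residuals on `Λ' ⊇ Λ₇` -/

section PolyWide

variable {α β : Type*}

/-- **KERNEL FORM OF THE PAIR NODE‴, SEMANTIC RESIDUALS, ON A LARGER WINDOW `Λ' ⊇ Λ₇`** — letters `d : α → Orb (PolySite Λ')`, dictionaries and all
families in `𝔄_{Λ'}`, objectives `hX_v : termOp d TX_v = Γ(incl h7)(X s_v)`; every staged edition (chain / hinted-quotient / adjoint) feeds `hR_v` as before.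
[cite: WangEtAl2024, §III] [cite: JanssonChaykinKeil2008, §3] -/
theorem SquareTTPrimePinnedPairRowT.of_residPolys_wide
    (U : ℚ) (hU : 0 ≤ U) (n₀ : ℚ) (hn0 : 0 ≤ n₀) (hn2 : n₀ < 2) (sA sB : ℚ)
    {Λ Λ' : Finset (Site 2)} (h7 : box 2 7 ⊆ Λ') (hΛ : Λ ⊆ Λ') (h8 : thicken Λ 1 ⊆ Λ')
    (h0 : thicken ({0} : Finset (Site 2)) 1 ⊆ Λ') (hz : (0 : Site 2) ∈ Λ')
    -- letters (shared)
    (d : α → Orb (PolySite Λ'))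
    (dΛ : β → Orb (PolySite Λ)) (f : β → α) (hf : ∀ b, d (f b) = Orb.embMap (PolySite.incl hΛ) (dΛ b))
    (sp : α → Fin 2) (hsp : ∀ a, (ofLex (d a)).2 = sp a)
    (o : Fin 2 → α) (ho : ∀ σ, d (o σ) = orb (PolySite.pt 0 hz) σ)
    -- the objective family and the SHARED eom words
    (X : ℝ → FermionOp (box 2 7)) (EB : List (Terms β))
    -- vertex A
    (THA : Terms α) (hHA : termOp d THA = (hubbardTTPrimeFermionInteraction 1 (sA : ℝ) (U : ℝ)).localHamiltonian Λ')
    (TEA : Terms α)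
    (hEA : termOp d TEA = fermionEmbed (PolySite.incl h0) ((hubbardTTPrimeFermionInteraction 1 (sA : ℝ) (U : ℝ)).meanEnergyObs 1))
    (TXA : Terms α) (hXA : termOp d TXA = fermionEmbed (PolySite.incl h7) (X (sA : ℝ))) (μA : Fin 2 → ℚ) (νA κA capA κA' flA : ℚ)
    (TGA : Terms α) {mA : Type*} [Fintype mA] [DecidableEq mA] {ΛmA : Matrix mA mA ℂ} (hΛmA : ΛmA.PosSemidef)
    (OA : mA → FermionOp Λ') (hGA : termOp d TGA = gramForm ΛmA OA)
    {nSA : ℕ} (γA : Fin nSA → DihedralGroup 4) (wvA : Fin nSA → Site 2) (hshA : ∀ l, d4ShiftSet (γA l) (wvA l) Λ ⊆ Λ')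
    (gA : Fin nSA → β → α)
    (hgA : ∀ l b, d (gA l b) = Orb.embMap (PolySite.incl (hshA l)) (Orb.embMap (PolySite.d4Emb (γA l) (wvA l) Λ) (dΛ b)))
    (SYA : Fin nSA → Terms β) (CWA : Terms α) (hcwA : ∀ wc ∈ CWA, chargeW wc.1 ≠ 0 ∨ spinChargeW sp wc.1 ≠ 0) (AVA : List (Terms α))
    {RA : CARPoly.Poly α}
    (hRA : evalPoly d RA = termOp d (residTG TXA μA νA o κA capA κA' flA TEA TGA THA f EB gA SYA CWA AVA))
    {βA : ℚ} (hβA : βA ≤ lowerConst RA + (μA 0 + μA 1) * (n₀ / 2 - νA))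
    -- vertex B
    (THB : Terms α) (hHB : termOp d THB = (hubbardTTPrimeFermionInteraction 1 (sB : ℝ) (U : ℝ)).localHamiltonian Λ')
    (TEB : Terms α)
    (hEB : termOp d TEB = fermionEmbed (PolySite.incl h0) ((hubbardTTPrimeFermionInteraction 1 (sB : ℝ) (U : ℝ)).meanEnergyObs 1))
    (TXB : Terms α) (hXB : termOp d TXB = fermionEmbed (PolySite.incl h7) (X (sB : ℝ))) (μB : Fin 2 → ℚ) (νB κB capB κB' flB : ℚ)
    (TGB : Terms α) {mB : Type*} [Fintype mB] [DecidableEq mB] {ΛmB : Matrix mB mB ℂ} (hΛmB : ΛmB.PosSemidef)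
    (OB : mB → FermionOp Λ') (hGB : termOp d TGB = gramForm ΛmB OB)
    {nSB : ℕ} (γB : Fin nSB → DihedralGroup 4) (wvB : Fin nSB → Site 2) (hshB : ∀ l, d4ShiftSet (γB l) (wvB l) Λ ⊆ Λ')
    (gB : Fin nSB → β → α)
    (hgB : ∀ l b, d (gB l b) = Orb.embMap (PolySite.incl (hshB l)) (Orb.embMap (PolySite.d4Emb (γB l) (wvB l) Λ) (dΛ b)))
    (SYB : Fin nSB → Terms β) (CWB : Terms α) (hcwB : ∀ wc ∈ CWB, chargeW wc.1 ≠ 0 ∨ spinChargeW sp wc.1 ≠ 0) (AVB : List (Terms α))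
    {RB : CARPoly.Poly α}
    (hRB : evalPoly d RB = termOp d (residTG TXB μB νB o κB capB κB' flB TEB TGB THB f EB gB SYB CWB AVB))
    {βB : ℚ} (hβB : βB ≤ lowerConst RB + (μB 0 + μB 1) * (n₀ / 2 - νB)) :
    SquareTTPrimePinnedPairRowT (U : ℝ) (n₀ : ℝ) (sA : ℝ) (sB : ℝ) capA capB flA flB βA κA κA' βB κB κB' X := by
  have hUr : (0 : ℝ) ≤ ((U : ℚ) : ℝ) := by exact_mod_cast hU
  have hn0r : (0 : ℝ) ≤ ((n₀ : ℚ) : ℝ) := by exact_mod_cast hn0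
  have hn2r : ((n₀ : ℚ) : ℝ) < 2 := by exact_mod_cast hn2
  -- (1) the two window identities from the semantic residuals, on the objectives `X sA`, `X sB`
  have hcertA := CARPolyWindow.windowIdentity_of_residPoly hΛ hz d dΛ f hf THA _ hHA TEA _ hEA o ho TXA μA νA κA
    capA κA' flA TGA ΛmA OA hGA EB γA wvA hshA gA hgA SYA CWA AVA hRA
  rw [hXA] at hcertA
  have hcertB := CARPolyWindow.windowIdentity_of_residPoly hΛ hz d dΛ f hf THB _ hHB TEB _ hEB o ho TXB μB νB κB
    capB κB' flB TGB ΛmB OB hGB EB γB wvB hshB gB hgB SYB CWB AVB hRB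
  rw [hXB] at hcertB
  -- (2) the charged words are charged (decided on the syntax)
  have hcwA' := CARPolyWindow.charged_of_hcw d sp hsp CWA hcwA
  have hcwB' := CARPolyWindow.charged_of_hcw d sp hsp CWB hcwB
  -- (3) the prices are the engine's `lowerConst`
  have hβA' : ((βA : ℚ) : ℝ) ≤ ((constCoeff RA : ℚ) : ℝ) - ∑ k ∈ (Finset.univ : Finset (Fin RA.length)), ‖resCoeff RA k‖ +
      (∑ σ : Fin 2, ((μA σ : ℚ) : ℝ)) * (((n₀ : ℚ) : ℝ) / 2 - ((νA : ℚ) : ℝ)) := by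
    rw [constCoeff_sub_sum_norm_resCoeff RA, Fin.sum_univ_two]
    have h2 : ((βA : ℚ) : ℝ) ≤ (((lowerConst RA + (μA 0 + μA 1) * (n₀ / 2 - νA) : ℚ)) : ℝ) := by exact_mod_cast hβA
    push_cast at h2
    linarith
  have hβB' : ((βB : ℚ) : ℝ) ≤ ((constCoeff RB : ℚ) : ℝ) - ∑ k ∈ (Finset.univ : Finset (Fin RB.length)), ‖resCoeff RB k‖ +
      (∑ σ : Fin 2, ((μB σ : ℚ) : ℝ)) * (((n₀ : ℚ) : ℝ) / 2 - ((νB : ℚ) : ℝ)) := by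
    rw [constCoeff_sub_sum_norm_resCoeff RB, Fin.sum_univ_two]
    have h2 : ((βB : ℚ) : ℝ) ≤ (((lowerConst RB + (μB 0 + μB 1) * (n₀ / 2 - νB) : ℚ)) : ℝ) := by exact_mod_cast hβB
    push_cast at h2
    linarith
  -- (4) the identity-level pair theorem, with the SHARED eom words `B_k := termOp dΛ (EB.get k)`
  exact SquareTTPrimePinnedPairRowT.of_windowIdentities_wide hUr hn0r hn2r (sA : ℝ) (sB : ℝ) h7 hΛ h8 h0 hz X
    (Finset.univ : Finset (Fin EB.length)) (fun k => termOp dΛ (EB.get k))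
    (fun σ => ((μA σ : ℚ) : ℝ)) ((νA : ℚ) : ℝ) capA flA κA κA' hΛmA OA Finset.univ γA wvA hshA (fun l => termOp dΛ (SYA l))
    Finset.univ (fun j => (((CWA.get j).2 : ℚ) : ℂ)) (fun j => wmap d (CWA.get j).1) hcwA' Finset.univ (fun _ => (1 : ℝ))
    (fun m' => termOp d (AVA.get m')) Finset.univ (resCoeff RA) (resWord d RA) hcertA hβA'
    (fun σ => ((μB σ : ℚ) : ℝ)) ((νB : ℚ) : ℝ) capB flB κB κB' hΛmB OB Finset.univ γB wvB hshB (fun l => termOp dΛ (SYB l))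
    Finset.univ (fun j => (((CWB.get j).2 : ℚ) : ℂ)) (fun j => wmap d (CWB.get j).1) hcwB' Finset.univ (fun _ => (1 : ℝ))
    (fun m' => termOp d (AVB.get m')) Finset.univ (resCoeff RB) (resWord d RB) hcertB hβB'

end PolyWide

end Summit.Ventures.CertifiedManyBodySolver.Downfold

end
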